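import Literature.MathematicalPhysics.QuantumLattice.BdGZeroModeTrotterDeterminant
import Literature.MathematicalPhysics.QuantumLattice.BdGBondHamiltonianFreeEnergyBounds
import Summits.HubbardSuperconductivity.HubbardSuperconductivity.Theorems.BalabanIRBirGappedPhaseReductionTorusModes
import HarnessLib

/-!
# Route BalabanIR — crux 4 `BirGappedPhaseReduction` / 4R (items `stmt-HubbardSuperconductivity-2082`, `…-14846`):
# end to end — the Fock weight of a zero-mode phase history of the BdG torus reference, mode by mode

Assembly of the chain Trotter determinant formula → gauge telescoping
(`Literature/…/BdGZeroModeTrotterDeterminant`) → de Gennes block form on the torus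
(`bdgNambuMatrix_transport_eq_reindex_fromBlocks`) → plane-wave mode factorisation (`…TorusModes`):

* `gibbsWeight_reindex_self`, `det_one_add_prod_map_reindex` (reindexing bookkeeping),
  `sub_chemicalPotential_eq_circulant`, `nambuPhase_eq_reindex_fromBlocks` (the one-body gauge step,
  transported, is `diag(e^{-iδ/2}·1, e^{+iδ/2}·1)`);
* **`trace_prod_gibbsWeight_bdgTorus_phase_eq_prod_modes`** — for a relabelling `e : Λ ≃ (ℤ/L)²` of the
  Jordan–Wigner sites, even translation-invariant hopping `η` and gap data `Δv`, `μ`, `a`, and a closed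
  history of GLOBAL pair phases `θ_t` (`t : Fin (m+1)`, cyclic):
  `Tr ∏_t e^{-aH_BdG(η(e·-e·), e^{iθ_t}·(-½ conj Δv(e·-e·)), μ)} = e^{-a(m+1)|Λ|(η 0 - μ)} · ∏_k det(1₂ + ∏_t e^{-a h_k} diag(e^{-iδ_t/2}, e^{+iδ_t/2}))`,
  `δ_t = θ_{t+1} - θ_t`, `h_k = !![η̂′ k, Δ̂ k; conj Δ̂ k, -η̂′ k]`, `η′ = η - μδ₀` — the FOCK-LEVEL weight of the
  route's reference for a zero-mode phase history is an explicit product of one-mode two-state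
  determinants, each bounded uniformly in the number of slices by
  `…TemporalModes.norm_det_one_add_prod_torusBdG_le` (temporal half of hypothesis (C), zero mode).

`Theses`-free, no definitions; `--supports` the crux. [folklore]
-/

noncomputable section

namespace Summit.HubbardSuperconductivity.HubbardSuperconductivity.Theorems

namespace BirBdG

open Matrix NormedSpace Literature.Probability.LatticeModels Literature.MathematicalPhysics.QuantumLattice
open scoped ComplexConjugate

section TorusWeight

variable {Λ : Type*} [LinearOrder Λ] [Fintype Λ] {L : ℕ} [NeZero L]

/-- Gibbs weights commute with reindexing along an equivalence. [folklore] -/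
theorem gibbsWeight_reindex_self {p q : Type*} [Fintype p] [Fintype q] [DecidableEq p] [DecidableEq q]
    (E : p ≃ q) (a : ℝ) (M : Matrix p p ℂ) :
    Matrix.gibbsWeight a (reindex E E M) = reindex E E (Matrix.gibbsWeight a M) := by
  rw [Matrix.gibbsWeight, Matrix.gibbsWeight, ← coe_reindexAlgEquiv (R := ℂ) (A := ℂ), ← map_smul]
  open scoped Matrix.Norms.Operator in
  exact (map_exp (reindexAlgEquiv ℂ ℂ E) (continuous_id.matrix_reindex _ _) _).symm

/-- A Trotter determinant of reindexed factors is the Trotter determinant of the factors.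
[folklore] -/
theorem det_one_add_prod_map_reindex {p q : Type*} [Fintype p] [Fintype q] [DecidableEq p] [DecidableEq q]
    (E : p ≃ q) {α : Type*} (l : List α) (F : α → Matrix p p ℂ) :
    (1 + (l.map fun x => reindex E E (F x)).prod).det = (1 + (l.map F).prod).det := by
  rw [← coe_reindexAlgEquiv (R := ℂ) (A := ℂ),
    show (l.map fun x => reindexAlgEquiv ℂ ℂ E (F x)) = (l.map F).map (reindexAlgEquiv ℂ ℂ E) by
      rw [List.map_map]; rfl,
    ← map_list_prod, ← map_one (reindexAlgEquiv ℂ ℂ E), ← map_add, coe_reindexAlgEquiv, det_reindex_self]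

omit [NeZero L] in
/-- The hopping-minus-chemical-potential block of translation-invariant data is circulant:
`circulant η - μ·1 = circulant (η - μ δ₀)`. [folklore] -/
theorem sub_chemicalPotential_eq_circulant (η : TorusSite 2 L → ℂ) (μ : ℝ) :
    (fun x y : TorusSite 2 L => η (x - y) - (if x = y then (μ : ℂ) else 0)) =
      circulant (fun r => η r - if r = 0 then (μ : ℂ) else 0) := by
  funext x y
  rw [circulant_apply]
  by_cases h : x = y
  · subst h
    simp
  · rw [if_neg h, if_neg (sub_ne_zero.mpr h)]

omit [Fintype Λ] [NeZero L] in
/-- The one-body Nambu gauge rotation, transported to the doubled torus index, is the block-scalar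
matrix `diag(e^{-iδ/2}·1, e^{+iδ/2}·1)`. [folklore] -/
theorem nambuPhase_eq_reindex_fromBlocks (e : Λ ≃ TorusSite 2 L) (δ : ℝ) :
    (nambuPhase δ : Matrix (Orb Λ) (Orb Λ) ℂ) =
      reindex ((e.symm.sumCongr e.symm).trans nambuEquiv) ((e.symm.sumCongr e.symm).trans nambuEquiv)
        (fromBlocks (Complex.exp (((-(δ / 2) : ℝ) : ℂ) * Complex.I) •
            (1 : Matrix (TorusSite 2 L) (TorusSite 2 L) ℂ)) 0 0
          (Complex.exp (((δ / 2 : ℝ) : ℂ) * Complex.I) • 1)) := by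
  set E : TorusSite 2 L ⊕ TorusSite 2 L ≃ Orb Λ := (e.symm.sumCongr e.symm).trans nambuEquiv with hE
  ext o o'
  obtain ⟨s, rfl⟩ := E.surjective o
  obtain ⟨s', rfl⟩ := E.surjective o'
  rw [reindex_apply, submatrix_apply, Equiv.symm_apply_apply, Equiv.symm_apply_apply, nambuPhase,
    diagonal_apply]
  rcases s with u | u <;> rcases s' with v | v
  · simp [hE, Matrix.one_apply, e.symm.injective.eq_iff]
  · simp [hE]
  · simp [hE]
  · simp [hE, Matrix.one_apply, e.symm.injective.eq_iff]

/-- **End to end: the Fock weight of a zero-mode phase history of the translation-invariant BdG torus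
reference is an explicit product of one-mode two-state determinants.** For a relabelling
`e : Λ ≃ (ℤ/L)²` of the Jordan–Wigner sites, translation-invariant EVEN hopping `η` and (singlet, bond)
gap data `Δv` on `(ℤ/L)²`, chemical potential `μ`, step `a` and a closed history of global pair phases
`θ_t` (`t : Fin (m+1)`, cyclic `t+1`):
`Tr ∏_t e^{-aH_BdG(η∘(e·-e·), e^{iθ_t}·(-½ conj Δv∘(e·-e·)), μ)}`
`= e^{-a(m+1)·|Λ|(η 0 - μ)} · ∏_k det(1₂ + ∏_t e^{-a h_k} diag(e^{-iδ_t/2}, e^{+iδ_t/2}))`,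
`δ_t = θ_{t+1} - θ_t`, `h_k = !![η̂′ k, Δ̂ k; conj Δ̂ k, -η̂′ k]`, `η′ = η - μδ₀` (`^ = torusFourier`).
Chain: Trotter determinant formula + gauge telescoping (`Literature/…/BdGZeroModeTrotterDeterminant`),
transport to de Gennes' block form (`bdgNambuMatrix_transport_eq_reindex_fromBlocks`), plane-wave mode
factorisation (`…TorusModes`). The temporal-coercivity bound of each factor is
`…TemporalModes.norm_det_one_add_prod_torusBdG_le`. [folklore] -/
theorem trace_prod_gibbsWeight_bdgTorus_phase_eq_prod_modes (e : Λ ≃ TorusSite 2 L)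
    (η Δv : TorusSite 2 L → ℂ) (hη : ∀ r, η (-r) = η r) (hΔ : ∀ r, Δv (-r) = Δv r) (μ a : ℝ)
    {m : ℕ} (θ : Fin (m + 1) → ℝ) :
    ((List.ofFn fun t => Matrix.gibbsWeight a
        (bdgBondHamiltonian (fun u v => η (e u - e v))
          (fun u v => Complex.exp (Complex.I * θ t) * (-(1 / 2 : ℂ) * star (Δv (e u - e v)))) μ)).prod).trace =
      Complex.exp (-(a : ℂ) * ∑ _t : Fin (m + 1), ∑ _x : Λ, (η 0 - μ)) *
        ∏ k : TorusSite 2 L, (1 + (List.ofFn fun t : Fin (m + 1) =>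
          Matrix.gibbsWeight a (!![torusFourier (fun r => η r - if r = 0 then (μ : ℂ) else 0) k,
              torusFourier Δv k; star (torusFourier Δv k),
              -torusFourier (fun r => η r - if r = 0 then (μ : ℂ) else 0) k] : Matrix (Fin 2) (Fin 2) ℂ) *
          diagonal ![Complex.exp (((-((θ (t + 1) - θ t) / 2) : ℝ) : ℂ) * Complex.I),
            Complex.exp ((((θ (t + 1) - θ t) / 2 : ℝ) : ℂ) * Complex.I)]).prod).det := by
  -- Step 1: Fock trace = determinant of the jumps
  rw [trace_prod_gibbsWeight_bdgBondHamiltonian_phase]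
  have hsum : (∑ _t : Fin (m + 1), ∑ x : Λ, (η (e x - e x) - (μ : ℂ))) =
      ∑ _t : Fin (m + 1), ∑ _x : Λ, (η 0 - μ) := by
    simp only [sub_self]
  rw [hsum]
  congr 1
  -- Step 2: transport the Nambu matrix and the gauge steps to de Gennes' block form on the torus
  have hτ₀ : ∀ x y : TorusSite 2 L, η (x - y) = η (y - x) := fun x y => by rw [← neg_sub, hη]
  have hD : ∀ x y : TorusSite 2 L, circulant Δv x y = circulant Δv y x := fun x y => by
    rw [circulant_apply, circulant_apply, ← neg_sub, hΔ]
  have hN := bdgNambuMatrix_transport_eq_reindex_fromBlocks e (fun x y => η (x - y)) hτ₀ (circulant Δv) hD μ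
  simp only [circulant_apply] at hN
  rw [show (fun u v => -(1 / 2 : ℂ) * star (Δv (e u - e v))) =
      fun u v => -(1 / 2 : ℂ) * star (Δv (e u - e v)) from rfl] at hN
  have hfac : ∀ t : Fin (m + 1),
      Matrix.gibbsWeight a (bdgNambuMatrix (fun u v => η (e u - e v))
          (fun u v => -(1 / 2 : ℂ) * star (Δv (e u - e v))) μ) * nambuPhase (θ (t + 1) - θ t) =
        reindex ((e.symm.sumCongr e.symm).trans nambuEquiv) ((e.symm.sumCongr e.symm).trans nambuEquiv)
          (Matrix.gibbsWeight a
            (fromBlocks (circulant fun r => η r - if r = 0 then (μ : ℂ) else 0) (circulant Δv)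
              (circulant Δv)ᴴ (-circulant fun r => η r - if r = 0 then (μ : ℂ) else 0)) *
            fromBlocks (Complex.exp (((-((θ (t + 1) - θ t) / 2) : ℝ) : ℂ) * Complex.I) •
                (1 : Matrix (TorusSite 2 L) (TorusSite 2 L) ℂ)) 0 0
              (Complex.exp ((((θ (t + 1) - θ t) / 2 : ℝ) : ℂ) * Complex.I) • 1)) := by
    intro t
    rw [hN, nambuPhase_eq_reindex_fromBlocks e, gibbsWeight_reindex_self, sub_chemicalPotential_eq_circulant,
      ← coe_reindexAlgEquiv (R := ℂ) (A := ℂ), ← map_mul]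
    congr 2
  rw [show (List.ofFn fun t : Fin (m + 1) => Matrix.gibbsWeight a (bdgNambuMatrix (fun u v => η (e u - e v))
        (fun u v => -(1 / 2 : ℂ) * star (Δv (e u - e v))) μ) * nambuPhase (θ (t + 1) - θ t)) =
      (List.ofFn fun t : Fin (m + 1) => θ (t + 1) - θ t).map fun δ =>
        reindex ((e.symm.sumCongr e.symm).trans nambuEquiv) ((e.symm.sumCongr e.symm).trans nambuEquiv)
        (Matrix.gibbsWeight a
          (fromBlocks (circulant fun r => η r - if r = 0 then (μ : ℂ) else 0) (circulant Δv)
            (circulant Δv)ᴴ (-circulant fun r => η r - if r = 0 then (μ : ℂ) else 0)) *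
          fromBlocks (Complex.exp (((-(δ / 2) : ℝ) : ℂ) * Complex.I) •
              (1 : Matrix (TorusSite 2 L) (TorusSite 2 L) ℂ)) 0 0
            (Complex.exp (((δ / 2 : ℝ) : ℂ) * Complex.I) • 1)) by
      rw [List.map_ofFn]; exact congrArg List.ofFn (funext hfac),
    det_one_add_prod_map_reindex, det_one_add_prod_torusBdG_eq_prod_modes]
  refine Finset.prod_congr rfl fun k _ => ?_
  rw [List.map_ofFn]
  rfl

end TorusWeight

end BirBdG

end Summit.HubbardSuperconductivity.HubbardSuperconductivity.Theorems
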